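import Summits.Ventures.QEC.Thresholds.ToricCodeThresholdKernelPT
import Literature.Probability.RandomPlanarGeometry.SAWFiniteMemoryZ3KernelK8One
import HarnessLib

/-!
# Phenomenological toric-code threshold from the KERNEL-checked memory-8 bound `μ(ℤ³) ≤ 4.778`:
# `p_c > .0110` (noisy measurement, `q = p`), unconditional, tier CERTIFIED (kernel)

Venture QEC, `Summits/Ventures/QEC/Thresholds/` (continues `ToricCodeThresholdKernelPT.lean`; LADDER item 03.PTMEM).
Input: `SAW.Zd.FiniteMemory3.connectiveConstant_three_le_47780_div` (`μ(ℤ³) ≤ 47780/10000`; `SAWFiniteMemoryZ3KernelK8One.lean`: the `9505`-state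
memory-8 Pönitz–Tittmann trie certificate of `ℤ³`, checked by `decide +kernel`, axioms standard; Table 2, `d = 3, k = 8`).
Through `phenomThreshold_connectiveConstant_three_le` (the DKLP space-time polygon theorem, unconditional):

| theorem | statement | tier |
|---|---|---|
| `phenomThreshold_kernelZ3K8` | threshold `≥ p₀(4.778)` for every poly-bounded schedule and every min-weight space-time decoder family | CERTIFIED (kernel), unconditional |
| `thresholdValue_4778_bounds` | `.0110 < p₀(4.778) < .0111` | kernel arithmetic |
| `phenom_accuracyThreshold_gt_0110`, `ToricCode.phenom_accuracyThreshold_stMinWeight_gt_0110`, `phenom_decaysExponentially_0110` | **`p_c > .0110`** (kernel decimals so far `.0101 → .0106 → .0109`) | CERTIFIED (kernel), unconditional |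

The CHECKED-native value (`μ(ℤ³) ≤ 4.76`, `native_decide`: `.0111`) remains one notch better at its tier; the
CONDITIONAL `.0112` needs the Pönitz–Tittmann `k = 14` fact. NOT A THEOREM ANYWHERE: DKLP's printed `.0114`.

## References

* [DennisEtAl2002] E. Dennis, A. Kitaev, A. Landahl, J. Preskill, J. Math. Phys. 43 (2002) 4452,
  arXiv:quant-ph/0110143, §5.3 eqs. (saw_3), (threshold_iso_num), (fail_iso).
* [PonitzTittmann2000] A. Pönitz, P. Tittmann, Electron. J. Combin. 7 (2000) R21, Table 2 (`d = 3`, `k = 8`: `4.7780`).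
-/

noncomputable section

namespace Summit.Ventures.QEC.Thresholds

open Filter Topology Finset
open Literature.InformationTheory.QuantumCodes
open Literature.InformationTheory.QuantumCodes.ToricCode
open Literature.Probability.RandomPlanarGeometry

/-- **Phenomenological toric threshold `≥ p₀(4.778)`, UNCONDITIONAL, tier CERTIFIED (kernel)** (memory-8 bound
`μ(ℤ³) ≤ 4.778`), for every polynomially bounded schedule and every minimum-weight space-time decoder family.
[cite: DennisEtAl2002, §5.3 eqs. (saw_3), (threshold_iso_num)] -/
theorem phenomThreshold_kernelZ3K8 {T : ℕ → ℕ} (hT : IsPolyBounded T)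
    {D : (L : ℕ) → STDecoder (L + 1) (T L)}
    (hD : ∀ L, (D L).IsMinWeight (stSyn (L + 1) (T L)) (stCycles (L + 1) (T L)) hammingNorm) :
    IsThresholdLowerBound (phenomFailureFamily T D) (thresholdValue 4.778) :=
  phenomThreshold_connectiveConstant_three_le (by norm_num)
    (SAW.Zd.FiniteMemory3.connectiveConstant_three_le_47780_div.trans (by norm_num)) hT hD

/-- Decimal certificate: `.0110 < p₀(4.778) < .0111`. [cite: DennisEtAl2002, §5.3 eq. (threshold_iso_num)] -/
theorem thresholdValue_4778_bounds :
    (0.0110 : ℝ) < thresholdValue 4.778 ∧ thresholdValue 4.778 < 0.0111 := by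
  unfold thresholdValue
  constructor
  · have : Real.sqrt (1 - 1 / (4.778 : ℝ) ^ 2) < 0.9780 := by
      rw [Real.sqrt_lt' (by norm_num)]
      norm_num
    linarith
  · have : (0.9778 : ℝ) < Real.sqrt (1 - 1 / (4.778 : ℝ) ^ 2) := by
      rw [Real.lt_sqrt (by norm_num)]
      norm_num
    linarith

/-- **`p_c > .0110`** under phenomenological noise (`q = p`) for every minimum-weight space-time decoder family and every
polynomially bounded schedule — UNCONDITIONAL, tier CERTIFIED (kernel). [cite: DennisEtAl2002, §5.3 eq. (threshold_iso_num)] -/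
theorem phenom_accuracyThreshold_gt_0110 {T : ℕ → ℕ} (hT : IsPolyBounded T)
    {D : (L : ℕ) → STDecoder (L + 1) (T L)}
    (hD : ∀ L, (D L).IsMinWeight (stSyn (L + 1) (T L)) (stCycles (L + 1) (T L)) hammingNorm) :
    (0.0110 : ℝ) < accuracyThreshold (phenomFailureFamily T D) :=
  lt_of_lt_of_le thresholdValue_4778_bounds.1
    (le_accuracyThreshold (phenomThreshold_kernelZ3K8 hT hD) ((thresholdValue_le_half _).trans (by norm_num)))

/-- The canonical instance (`T(L) = L + 1`, canonical minimum-weight space-time decoders): `p_c > .0110` — UNCONDITIONAL,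
kernel. [cite: DennisEtAl2002, §5.3 eq. (threshold_iso_num)] -/
theorem ToricCode.phenom_accuracyThreshold_stMinWeight_gt_0110 :
    (0.0110 : ℝ) < accuracyThreshold
      (phenomFailureFamily (fun L => L + 1) fun L => Decoder.minWeight (stSyn (L + 1) (L + 1)) hammingNorm) :=
  phenom_accuracyThreshold_gt_0110 isPolyBounded_succ fun L => ToricCode.isMinWeight_stMinWeight (L + 1) (L + 1)

/-- **Exponential decay at every `0 ≤ p ≤ .0110`** under phenomenological noise, UNCONDITIONAL, kernel (cubic walk-count
constant at `ν = 4.78 > μ(ℤ³)`; `.0110 < p₀(4.78)`). [cite: DennisEtAl2002, §5.3 eq. (fail_iso)] -/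
theorem phenom_decaysExponentially_0110 {T : ℕ → ℕ} (hT : IsPolyBounded T)
    {D : (L : ℕ) → STDecoder (L + 1) (T L)}
    (hD : ∀ L, (D L).IsMinWeight (stSyn (L + 1) (T L)) (stCycles (L + 1) (T L)) hammingNorm)
    {p : ℝ} (hp₀ : 0 ≤ p) (hpp : p ≤ 0.0110) :
    DecaysExponentially (phenomFailureFamily T D) p := by
  have hlt : SAW.Zd.connectiveConstant 3 < 4.78 :=
    lt_of_le_of_lt SAW.Zd.FiniteMemory3.connectiveConstant_three_le_47780_div (by norm_num)
  obtain ⟨C, hC⟩ := exists_sawCountBound3_of_connectiveConstant_lt hlt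
  have hval : (0.0110 : ℝ) < thresholdValue 4.78 := by
    unfold thresholdValue
    have : Real.sqrt (1 - 1 / (4.78 : ℝ) ^ 2) < 0.9780 := by
      rw [Real.sqrt_lt' (by norm_num)]
      norm_num
    linarith
  exact phenom_decaysExponentially_sawCountBound3' (by norm_num) hC hT hD hp₀ (lt_of_le_of_lt hpp hval)

end Summit.Ventures.QEC.Thresholds

end
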